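import Summits.QuantumFields.BalabanUV.Beta.GAN24.SymRMChargeFree
import Summits.QuantumFields.BalabanUV.Beta.GAN24.SymLinKernelFaceSupport
import Summits.QuantumFields.BalabanUV.Beta.GAN24.WardResidualRotatedVertexWeighted

/-!
# `BalabanUV.Beta.GAN24.SymRMChargeFreeFace` — binder row G-an2-4 ∕ (CONV-C), CT-W route «WC-TL» ∕ (Q-R) «QR-LL», the (S) row of RULING R-gan24p1-g27-1, piece (S-β),
# PART 3b: **an1's MIXED WARD REMAINDER IS CHARGE-FREE PER LETTER IN THE EXIT-FACE (TRANSPORTED) CURRENCY — EVERY `cΛ`, NO Λ-LOCK** — the two-leg weight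
# `𝟙[x_β % Lc = Lc−1 ∧ x′_{β′} % Lc = Lc−1]` of p2 g35's sandwich read-out `SandwichReadoutSiteDep.hasSum_sandwich_readout_coDressKBmAt` (the charges the next S-step
# ACTUALLY reads; the OWNER gan24-p1 g27's E18 «transported ≤ 1.1e-13 per letter») kills `symWardM` and `symDatM` SEPARATELY (centred root, `Lc` odd; G-an2-4 formalisation
# swarm → CRUX TEAM (2), seat `b2b-balaban-gan24-formalise-leaf-02`, gen 55)

NOT IN PRINT; OUR BOOKKEEPING ([folklore] finite-sum algebra over PART 2 `GAN24.SymRMChargeFree` (entries, supports), PART 3a `GAN24.SymLinKernelFaceSupport` (the exit-face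
indicator is `dz` of the coarse coordinate; the pointwise vanishing), this seat's gen-47 `dψ`-laws `GAN24.SymHessianGaugeLegContact`, an1's objects BY NAME; 0 `def`, 0 cited
fact, 0 `def … : Prop`, 0 sorry).  HONEST FRAMING (cell contract, verbatim): «discharging `BetaPertH` makes Bałaban's UV stability UNCONDITIONAL — a real constructive-QFT
result; it is NOT the continuum limit and NOT the Clay problem.»  HONEST DEPENDENCY (verbatim): «continuum YM on T⁴ ⇐ BetaPertH ∧ nine spine estimates (0/9 proved);
BetaPertH ⇐ (D1) ∧ (D4) ∧ CAP+tail; G-an2-4 gates asym, D1 and NE2/3/4.»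

WHAT (`d = 3`, `[NeZero Lc]`, `Odd Lc`, root `ρ_c = ctr 4 Lc`; `h = symHessKerAt ρ_c Lc ρ′ w`, `q¹ = symLinKerAt ρ_c Lc ρ′ w`, face weight `φ_λ(x) := 𝟙[x_λ % Lc = Lc−1]`).
* §1 `tsum_symHessKerAt_row_face ∕ _col_face` — the `dψ`-laws with `ψ = ⌊·_λ ∕ Lc⌋`: `Σ'_{x′} h((β,x),(β′,x′))·φ_{β′}(x′) = −W^c_{β′}(β,x)·q¹(β,x)∕2`,
  `Σ'_x φ_β(x)·h((β,x),(β′,x′)) = W^c_β(β′,x′)·q¹(β′,x′)∕2`, `W^c_λ(α,x) = ⌊x_λ∕Lc⌋ + ⌊(x+e_α)_λ∕Lc⌋ − ⌊r_λ∕Lc⌋ − ⌊(r + Lc•e_{ρ′})_λ∕Lc⌋`.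
* §2 **`tsum_prod_face_mul_symHessKerAt_weight_eq_zero`**: for ANY one-slot multipliers `U`, `V`, `Σ'_{(x,x′)} φ_β(x)φ_{β′}(x′)·(U x + V x′)·h((β,x),(β′,x′)) = 0` — row ∕ column
  law and PART 3a §4 pointwise.
* §3 **`tsum_prod_face_symRWof_inl_inl`** (EVERY `cΛ`), **`tsum_prod_face_symRMAn1_inl_inl`** — (S-β) in the exit-face currency, every level, with p2's face weight
  `𝟙[x_α % Lc = Lc−1 ∧ x′_β % Lc = Lc−1]` on the channel `(inl α, inl β)` spelled VERBATIM as in `WardResidualRotatedVertexTransported`.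
* §4 **`hasSum_face_vertexOfM_symRMAn1`** ∕ `_comb` — the (β)-piece `vertexOfM G Lc (symRMAn1 Lc cΛ j y) ν y′` has ZERO exit-face two-leg charge at every slot, through any `G`
  with decaying multiplier columns (p2's `WardResidualRotatedVertexWeighted.hasSum_weighted_vertexOfM`), in particular the tower's `coDressKBmAt ρ_c Lc (KInvStep Lc j′)`.
HONEST: discharges (S-β) in the exit-face currency (the input of the sandwich read-out); the composition with p2's read-out itself (the transported (β)-letter as a coarse
kernel) is NOT typed here; NOTHING of (S) for α+γ ∕ (S-τ) ∕ (Q-R) ∕ (LT) ∕ (Q-L) ∕ (C) ∕ «T2Shape» ∕ (hW, hWall); NEVER «G-an2-4 closed» as (CONV-C); NOT D1, NOT `BetaPertH`,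
NOT continuum, NOT Clay.  2026-08-22; no existing file touched.
-/

noncomputable section

open Finset
open scoped BigOperators
open Literature.MathematicalPhysics.QuantumFieldTheory
open Literature.MathematicalPhysics.QuantumFieldTheory.Balaban1983to89
open Literature.MathematicalPhysics.QuantumFieldTheory.Balaban1983to89.Beta
open B12Sec2to5 (l1)
open ExpKernelCalculus (Site MKer VertexFamily)
open AffineAveraging (box toSite unitVec unitVec_apply dz)
open AveragingContours (blk)
open AveragingContoursRooted (ctr ctrOff ctr_apply ctrOff_mem_box)
open OneStepResolventKernel (Fib)
open OneStepKernelFamily (KInvStep)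
open SecondOrderResponse (colM vertexOfM abs_colM_le)
open Summit.QuantumFields.BalabanUV.Beta.AxialDressingRooted (one_le_of_neZero coDressKBmAt decays_coDressKBmAt_KInvStep)
open Summit.QuantumFields.BalabanUV.Beta.SymAveragingHessianCounts (symHessFFAt symHessKerAt symLinKerAt symHessFFAt_inl_inl)
open Summit.QuantumFields.BalabanUV.Beta.SymMixedWardPacking (symWardM symDatM symRWof)
open Summit.QuantumFields.BalabanUV.Beta.SymWardLettersAn1 (symRMAn1 vertexFamily_symRMAn1)
open Summit.QuantumFields.BalabanUV.Beta.LinearGaugeVH (nearBox mem_nearBox summable_of_finsupp)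
open Summit.QuantumFields.BalabanUV.Beta.GAN24.SymHessianGaugeLegContact (tsum_dz_mul_symHessFFAt tsum_symHessFFAt_mul_dz)
open Summit.QuantumFields.BalabanUV.Beta.GAN24.SymLinKernelFaceSupport (exitFace_eq_dz_blk dz_blk_of_ne exitFace_coarseWeight_mul_symLinKerAt_eq_zero)
open Summit.QuantumFields.BalabanUV.Beta.GAN24.SymRMChargeFree (symRWof_inl_inl_eq symHessKerAt_eq_zero_of_not_mem_left symHessKerAt_eq_zero_of_not_mem_right
  symRWof_eq_zero_of_not_mem summable_prod_symRWof)
open Summit.QuantumFields.BalabanUV.Beta.GAN24.WardResidualRotatedVertexWeighted (hasSum_weighted_vertexOfM)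

namespace Summit.QuantumFields.BalabanUV.Beta.GAN24.SymRMChargeFreeFace

variable {Lc : ℕ} [NeZero Lc]

/-! ## §1 Row and column sums of an1's symmetrised constraint Hessian against the exit-face indicator -/

/-- NOT IN PRINT; OUR BOOKKEEPING.  **ROW SUM AGAINST THE EXIT-FACE INDICATOR** (second-slot `dψ`-law with `ψ = ⌊·_{β′}∕Lc⌋`):
`Σ'_{x′} h((β,x),(β′,x′))·𝟙[x′_{β′} % Lc = Lc−1] = −W^c_{β′}(β,x)·q¹(β,x)∕2`. -/
theorem tsum_symHessKerAt_row_face (ρ' : Fin (3 + 1)) (w x : Fin (3 + 1) → ℤ) (β β' : Fin (3 + 1)) :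
    ∑' x', symHessKerAt (ctr 4 Lc) Lc ρ' w (β, x) (β', x') * (if x' β' % (Lc : ℤ) = (Lc : ℤ) - 1 then (1 : ℝ) else 0)
      = -((((x β' / (Lc : ℤ) : ℤ) : ℝ) + ((((x + unitVec β) β' / (Lc : ℤ) : ℤ)) : ℝ) - (((((Lc : ℤ) • w + ctr 4 Lc) β' / (Lc : ℤ) : ℤ)) : ℝ)
          - (((((Lc : ℤ) • w + ctr 4 Lc + (Lc : ℤ) • unitVec ρ') β' / (Lc : ℤ) : ℤ)) : ℝ)) * symLinKerAt (ctr 4 Lc) Lc ρ' w (β, x) / 2) := by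
  have h := tsum_symHessFFAt_mul_dz (one_le_of_neZero Lc) (ctrOff_mem_box (one_le_of_neZero Lc)) ρ' w x β
    (fun z : Fin (3 + 1) → ℤ => ((z β' / (Lc : ℤ) : ℤ) : ℝ))
  have hpt : ∀ x' : Fin (3 + 1) → ℤ,
      ∑ α', symHessFFAt (toSite (ctrOff (3 + 1) Lc)) Lc ρ' w x x' (Sum.inl β) (Sum.inl α')
          * dz (fun z : Fin (3 + 1) → ℤ => ((z β' / (Lc : ℤ) : ℤ) : ℝ)) α' x'
        = symHessKerAt (ctr 4 Lc) Lc ρ' w (β, x) (β', x') * (if x' β' % (Lc : ℤ) = (Lc : ℤ) - 1 then (1 : ℝ) else 0) := by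
    intro x'
    rw [Finset.sum_eq_single β']
    · rw [← exitFace_eq_dz_blk (one_le_of_neZero Lc), symHessFFAt_inl_inl]; rfl
    · intro α' _ hα'
      rw [dz_blk_of_ne β' hα', mul_zero]
    · exact fun h => absurd (Finset.mem_univ β') h
  simp only [hpt] at h
  rw [h]
  rfl

/-- NOT IN PRINT; OUR BOOKKEEPING.  **COLUMN SUM AGAINST THE EXIT-FACE INDICATOR** (first-slot `dψ`-law with `ψ = ⌊·_β∕Lc⌋`):
`Σ'_x 𝟙[x_β % Lc = Lc−1]·h((β,x),(β′,x′)) = W^c_β(β′,x′)·q¹(β′,x′)∕2`. -/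
theorem tsum_symHessKerAt_col_face (ρ' : Fin (3 + 1)) (w x' : Fin (3 + 1) → ℤ) (β β' : Fin (3 + 1)) :
    ∑' x, (if x β % (Lc : ℤ) = (Lc : ℤ) - 1 then (1 : ℝ) else 0) * symHessKerAt (ctr 4 Lc) Lc ρ' w (β, x) (β', x')
      = (((x' β / (Lc : ℤ) : ℤ) : ℝ) + ((((x' + unitVec β') β / (Lc : ℤ) : ℤ)) : ℝ) - (((((Lc : ℤ) • w + ctr 4 Lc) β / (Lc : ℤ) : ℤ)) : ℝ)
          - (((((Lc : ℤ) • w + ctr 4 Lc + (Lc : ℤ) • unitVec ρ') β / (Lc : ℤ) : ℤ)) : ℝ)) * symLinKerAt (ctr 4 Lc) Lc ρ' w (β', x') / 2 := by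
  have h := tsum_dz_mul_symHessFFAt (one_le_of_neZero Lc) (ctrOff_mem_box (one_le_of_neZero Lc)) ρ' w x' β'
    (fun z : Fin (3 + 1) → ℤ => ((z β / (Lc : ℤ) : ℤ) : ℝ))
  have hpt : ∀ x : Fin (3 + 1) → ℤ,
      ∑ α, dz (fun z : Fin (3 + 1) → ℤ => ((z β / (Lc : ℤ) : ℤ) : ℝ)) α x * symHessFFAt (toSite (ctrOff (3 + 1) Lc)) Lc ρ' w x x' (Sum.inl α) (Sum.inl β')
        = (if x β % (Lc : ℤ) = (Lc : ℤ) - 1 then (1 : ℝ) else 0) * symHessKerAt (ctr 4 Lc) Lc ρ' w (β, x) (β', x') := by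
    intro x
    rw [Finset.sum_eq_single β]
    · rw [← exitFace_eq_dz_blk (one_le_of_neZero Lc), symHessFFAt_inl_inl]; rfl
    · intro α _ hα
      rw [dz_blk_of_ne β hα, zero_mul]
    · exact fun h => absurd (Finset.mem_univ β) h
  simp only [hpt] at h
  rw [h]
  rfl

/-! ## §2 Every exit-face ⊗ exit-face pairing of `h` with one-slot multipliers vanishes -/

/-- NOT IN PRINT; OUR BOOKKEEPING.  **EXIT-FACE ⊗ EXIT-FACE PAIRINGS OF an1's SYMMETRISED CONSTRAINT HESSIAN WITH ONE-SLOT MULTIPLIERS VANISH** (centred root, `Lc` odd):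
for ANY `U V : Site → ℝ`, `Σ'_{(x,x′)} 𝟙[x_β % Lc = Lc−1]·𝟙[x′_{β′} % Lc = Lc−1]·(U x + V x′)·h((β,x),(β′,x′)) = 0` — the `U`-part is a face-restricted ROW sum, the `V`-part a
face-restricted COLUMN sum (§1), and PART 3a's `exitFace_coarseWeight_mul_symLinKerAt_eq_zero` kills both integrands pointwise. -/
theorem tsum_prod_face_mul_symHessKerAt_weight_eq_zero (hodd : Odd Lc) (ρ' : Fin (3 + 1)) (w : Fin (3 + 1) → ℤ) (β β' : Fin (3 + 1))
    (U V : (Fin (3 + 1) → ℤ) → ℝ) :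
    ∑' xz : (Fin (3 + 1) → ℤ) × (Fin (3 + 1) → ℤ),
        (if xz.1 β % (Lc : ℤ) = (Lc : ℤ) - 1 then (1 : ℝ) else 0) * (if xz.2 β' % (Lc : ℤ) = (Lc : ℤ) - 1 then (1 : ℝ) else 0)
          * (U xz.1 + V xz.2) * symHessKerAt (ctr 4 Lc) Lc ρ' w (β, xz.1) (β', xz.2) = 0 := by
  classical
  set nb : Finset (Fin (3 + 1) → ℤ) := nearBox Lc w with hnb
  set fβ : (Fin (3 + 1) → ℤ) → ℝ := fun z => if z β % (Lc : ℤ) = (Lc : ℤ) - 1 then (1 : ℝ) else 0 with hfβ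
  set fβ' : (Fin (3 + 1) → ℤ) → ℝ := fun z => if z β' % (Lc : ℤ) = (Lc : ℤ) - 1 then (1 : ℝ) else 0 with hfβ'
  set hK : (Fin (3 + 1) → ℤ) → (Fin (3 + 1) → ℤ) → ℝ := fun x x' => symHessKerAt (ctr 4 Lc) Lc ρ' w (β, x) (β', x') with hhK
  show ∑' xz : (Fin (3 + 1) → ℤ) × (Fin (3 + 1) → ℤ), fβ xz.1 * fβ' xz.2 * (U xz.1 + V xz.2) * hK xz.1 xz.2 = 0
  -- finite support
  have hz : ∀ xz ∉ nb ×ˢ nb, fβ xz.1 * fβ' xz.2 * (U xz.1 + V xz.2) * hK xz.1 xz.2 = 0 := by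
    intro xz hxz
    have h0 : hK xz.1 xz.2 = 0 := by
      rw [Finset.mem_product, not_and_or] at hxz
      rcases hxz with h1 | h2
      · exact symHessKerAt_eq_zero_of_not_mem_left ρ' w h1 β β' xz.2
      · exact symHessKerAt_eq_zero_of_not_mem_right ρ' w β xz.1 β' h2
    rw [h0, mul_zero]
  have hsplit : ∀ x x', fβ x * fβ' x' * (U x + V x') * hK x x' = (fβ x * U x) * (hK x x' * fβ' x') + (fβ' x' * V x') * (fβ x * hK x x') := by
    intro x x'; ring
  rw [tsum_eq_sum hz, Finset.sum_product]
  simp only [hsplit, Finset.sum_add_distrib]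
  -- §1 on the two pieces
  have hrow : ∀ x, ∑ x' ∈ nb, hK x x' * fβ' x' = -((((x β' / (Lc : ℤ) : ℤ) : ℝ) + ((((x + unitVec β) β' / (Lc : ℤ) : ℤ)) : ℝ)
      - (((((Lc : ℤ) • w + ctr 4 Lc) β' / (Lc : ℤ) : ℤ)) : ℝ) - (((((Lc : ℤ) • w + ctr 4 Lc + (Lc : ℤ) • unitVec ρ') β' / (Lc : ℤ) : ℤ)) : ℝ))
      * symLinKerAt (ctr 4 Lc) Lc ρ' w (β, x) / 2) := by
    intro x
    have e : ∑' x', hK x x' * fβ' x' = ∑ x' ∈ nb, hK x x' * fβ' x' :=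
      tsum_eq_sum (f := fun x' => hK x x' * fβ' x') fun x' hx' => by
        show symHessKerAt (ctr 4 Lc) Lc ρ' w (β, x) (β', x') * fβ' x' = 0
        rw [symHessKerAt_eq_zero_of_not_mem_right ρ' w β x β' hx', zero_mul]
    rw [← e]
    exact tsum_symHessKerAt_row_face ρ' w x β β'
  have hcol : ∀ x', ∑ x ∈ nb, fβ x * hK x x' = (((x' β / (Lc : ℤ) : ℤ) : ℝ) + ((((x' + unitVec β') β / (Lc : ℤ) : ℤ)) : ℝ)
      - (((((Lc : ℤ) • w + ctr 4 Lc) β / (Lc : ℤ) : ℤ)) : ℝ) - (((((Lc : ℤ) • w + ctr 4 Lc + (Lc : ℤ) • unitVec ρ') β / (Lc : ℤ) : ℤ)) : ℝ))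
      * symLinKerAt (ctr 4 Lc) Lc ρ' w (β', x') / 2 := by
    intro x'
    have e : ∑' x, fβ x * hK x x' = ∑ x ∈ nb, fβ x * hK x x' :=
      tsum_eq_sum (f := fun x => fβ x * hK x x') fun x hx => by
        show fβ x * symHessKerAt (ctr 4 Lc) Lc ρ' w (β, x) (β', x') = 0
        rw [symHessKerAt_eq_zero_of_not_mem_left ρ' w hx β β' x', mul_zero]
    rw [← e]
    exact tsum_symHessKerAt_col_face ρ' w x' β β'
  have h1 : ∑ x ∈ nb, ∑ x' ∈ nb, (fβ x * U x) * (hK x x' * fβ' x') = 0 := by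
    refine Finset.sum_eq_zero fun x _ => ?_
    rw [← Finset.mul_sum, hrow x]
    have h0 := exitFace_coarseWeight_mul_symLinKerAt_eq_zero (d := 3) hodd ρ' w β β' x
    show (if x β % (Lc : ℤ) = (Lc : ℤ) - 1 then (1 : ℝ) else 0) * U x * _ = 0
    have e4 : ctr (3 + 1) Lc = ctr 4 Lc := rfl
    rw [e4] at h0
    linear_combination (-(U x) / 2) * h0
  have h2 : ∑ x ∈ nb, ∑ x' ∈ nb, (fβ' x' * V x') * (fβ x * hK x x') = 0 := by
    rw [Finset.sum_comm]
    refine Finset.sum_eq_zero fun x' _ => ?_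
    rw [← Finset.mul_sum, hcol x']
    have h0 := exitFace_coarseWeight_mul_symLinKerAt_eq_zero (d := 3) hodd ρ' w β' β x'
    show (if x' β' % (Lc : ℤ) = (Lc : ℤ) - 1 then (1 : ℝ) else 0) * V x' * _ = 0
    have e4 : ctr (3 + 1) Lc = ctr 4 Lc := rfl
    rw [e4] at h0
    linear_combination ((V x') / 2) * h0
  rw [h1, h2, add_zero]

/-! ## §3 The exit-face charge of the residual and of `symRMAn1` vanishes, every `cΛ` -/

/-- NOT IN PRINT; OUR BOOKKEEPING.  **(S-β) IN THE EXIT-FACE CURRENCY, FIELD–FIELD CHANNELS, EVERY `cΛ`** (centred root, `Lc` odd; NO Λ-lock):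
`Σ'_{(x,x′)} 𝟙[x_β % Lc = Lc−1 ∧ x′_{β′} % Lc = Lc−1] · symRWof Lc cΛ y ρ′ w x x′ (inl β) (inl β′) = 0` — by PART 2's entry formula the residual is `h·(U x + V x′)` with
one-slot multipliers (`U = (2∕Lc⁴)(𝟙[w=y] − 𝟙_B) + (cΛ∕2)𝟙_B`, `V = −(cΛ∕2)𝟙_B`), and §2 applies. -/
theorem tsum_prod_face_symRWof_inl_inl (hodd : Odd Lc) (cΛ : ℝ) (y : Fin (3 + 1) → ℤ) (ρ' : Fin (3 + 1)) (w : Fin (3 + 1) → ℤ) (β β' : Fin (3 + 1)) :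
    ∑' xz : (Fin (3 + 1) → ℤ) × (Fin (3 + 1) → ℤ),
        (if xz.1 β % (Lc : ℤ) = (Lc : ℤ) - 1 ∧ xz.2 β' % (Lc : ℤ) = (Lc : ℤ) - 1 then (1 : ℝ) else 0)
          * symRWof Lc cΛ y ρ' w xz.1 xz.2 (Sum.inl β) (Sum.inl β') = 0 := by
  have h := tsum_prod_face_mul_symHessKerAt_weight_eq_zero hodd ρ' w β β'
    (fun x => (2 / (Lc : ℝ) ^ (3 + 1)) * ((if w = y then (1 : ℝ) else 0) - (if blk Lc x = y then (1 : ℝ) else 0))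
      + cΛ * ((1 / 2 : ℝ) * (if blk Lc x = y then (1 : ℝ) else 0)))
    (fun x' => -(cΛ * ((1 / 2 : ℝ) * (if blk Lc x' = y then (1 : ℝ) else 0))))
  refine Eq.trans (tsum_congr fun xz => ?_) h
  rw [symRWof_inl_inl_eq]
  by_cases h1 : xz.1 β % (Lc : ℤ) = (Lc : ℤ) - 1
  · by_cases h2 : xz.2 β' % (Lc : ℤ) = (Lc : ℤ) - 1
    · rw [if_pos ⟨h1, h2⟩, if_pos h1, if_pos h2]; ring
    · rw [if_neg (fun hh => h2 hh.2), if_pos h1, if_neg h2]; ring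
  · rw [if_neg (fun hh => h1 hh.1), if_neg h1]; ring

/-- NOT IN PRINT; OUR BOOKKEEPING.  **(S-β) IN THE EXIT-FACE CURRENCY, EVERY LEVEL, EVERY `cΛ`** (centred root, `Lc` odd): with p2's face weight
`ω_{αβ}(x,x′) = 𝟙[x_α % Lc = Lc−1 ∧ x′_β % Lc = Lc−1]` on the channel `(inl α, inl β)` (the weight of `WardResidualRotatedVertexTransported.hasSum_prod_transported_rotatedVertex_comb`,
verbatim): `Σ'_{(x,x′)} ω_{αβ} · symRMAn1 Lc cΛ j y ρ′ w x x′ (inl α) (inl β) = 0`. -/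
theorem tsum_prod_face_symRMAn1_inl_inl (hodd : Odd Lc) (cΛ : ℝ) (j : ℕ) (y : Fin (3 + 1) → ℤ) (ρ' : Fin (3 + 1)) (w : Fin (3 + 1) → ℤ)
    (α β : Fin (3 + 1)) :
    ∑' xz : (Fin (3 + 1) → ℤ) × (Fin (3 + 1) → ℤ),
        (if xz.1 α % (Lc : ℤ) = (Lc : ℤ) - 1 ∧ xz.2 β % (Lc : ℤ) = (Lc : ℤ) - 1 then (1 : ℝ) else 0)
          * symRMAn1 Lc cΛ j y ρ' w xz.1 xz.2 (Sum.inl α) (Sum.inl β) = 0 := by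
  have e : ∀ xz : (Fin (3 + 1) → ℤ) × (Fin (3 + 1) → ℤ),
      (if xz.1 α % (Lc : ℤ) = (Lc : ℤ) - 1 ∧ xz.2 β % (Lc : ℤ) = (Lc : ℤ) - 1 then (1 : ℝ) else 0)
          * symRMAn1 Lc cΛ j y ρ' w xz.1 xz.2 (Sum.inl α) (Sum.inl β)
        = BalabanStepW2.wM1 3 Lc j * ((if xz.1 α % (Lc : ℤ) = (Lc : ℤ) - 1 ∧ xz.2 β % (Lc : ℤ) = (Lc : ℤ) - 1 then (1 : ℝ) else 0)
          * symRWof Lc cΛ y ρ' w xz.1 xz.2 (Sum.inl α) (Sum.inl β)) := by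
    intro xz; simp only [symRMAn1, Pi.smul_apply, smul_eq_mul]; ring
  rw [tsum_congr e, tsum_mul_left, tsum_prod_face_symRWof_inl_inl hodd cΛ y ρ' w α β, mul_zero]

/-! ## §4 The (β)-piece has zero exit-face two-leg charge at every slot -/

/-- NOT IN PRINT; OUR BOOKKEEPING.  **THE (β)-PIECE HAS ZERO EXIT-FACE CHARGE AT EVERY SLOT** (centred root, `Lc` odd, every `cΛ`): through ANY kernel `G` with decaying
multiplier columns, for every slot `(ν, y′)`, label `y`, level `j` and face channel `(α, β)`,
`HasSum (xz ↦ ω_{αβ}(xz) · vertexOfM G Lc (symRMAn1 Lc cΛ j y) ν y′ xz.1 xz.2 (inl α) (inl β)) 0` — p2's weighted value form `hasSum_weighted_vertexOfM` (bounded weight) with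
every letter's face charge `0` (§3).  This is the input of p2 g35's sandwich read-out for `V := (β)(ν,y′)`: the TRANSPORTED (β)-letter sees only these charges (PART 4). -/
theorem hasSum_face_vertexOfM_symRMAn1 (hodd : Odd Lc) (cΛ : ℝ) {G : MKer (3 + 1) (Fib 3)} {C' m : ℝ} {c₀ : Site (3 + 1)} (ν : Fin (3 + 1))
    (y' : Site (3 + 1)) (hw : ∀ (ρ : Fin (3 + 1)) (w : Site (3 + 1)), |colM G Lc ν y' ρ w| ≤ C' * Real.exp (-m * l1 ((Lc : ℤ) • w - c₀))) (hm : 0 < m)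
    (j : ℕ) (y : Fin (3 + 1) → ℤ) (α β : Fin (3 + 1)) :
    HasSum (fun xz : Site (3 + 1) × Site (3 + 1) =>
      (if xz.1 α % (Lc : ℤ) = (Lc : ℤ) - 1 ∧ xz.2 β % (Lc : ℤ) = (Lc : ℤ) - 1 then (1 : ℝ) else 0)
        * vertexOfM G Lc (symRMAn1 Lc cΛ j y) ν y' xz.1 xz.2 (Sum.inl α) (Sum.inl β)) 0 := by
  obtain ⟨C, δ, hδ, hV⟩ := vertexFamily_symRMAn1 (Lc := Lc) (one_le_of_neZero Lc) cΛ j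
  have hω : ∀ xz : Site (3 + 1) × Site (3 + 1),
      |(if xz.1 α % (Lc : ℤ) = (Lc : ℤ) - 1 ∧ xz.2 β % (Lc : ℤ) = (Lc : ℤ) - 1 then (1 : ℝ) else 0)| ≤ 1 := fun xz => by
    split_ifs <;> simp
  have h := (hasSum_weighted_vertexOfM (N := Lc) ν y' hw hm (hV y) hδ (Sum.inl α) (Sum.inl β) hω).1
  have hz : ∀ (ρ : Fin (3 + 1)) (w : Site (3 + 1)),
      ∑' xz : Site (3 + 1) × Site (3 + 1), (if xz.1 α % (Lc : ℤ) = (Lc : ℤ) - 1 ∧ xz.2 β % (Lc : ℤ) = (Lc : ℤ) - 1 then (1 : ℝ) else 0)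
        * symRMAn1 Lc cΛ j y ρ w xz.1 xz.2 (Sum.inl α) (Sum.inl β) = 0 :=
    fun ρ w => tsum_prod_face_symRMAn1_inl_inl hodd cΛ j y ρ w α β
  simp only [hz, mul_zero, tsum_zero, Finset.sum_const_zero] at h
  exact h

/-- NOT IN PRINT; OUR BOOKKEEPING.  **THE COMB INSTANCE, HYPOTHESIS-FREE** beyond `Odd Lc`: `G = coDressKBmAt ρ_c Lc (KInvStep Lc j′)`, ANY `cΛ`, ANY levels `j′ j`. -/
theorem hasSum_face_vertexOfM_symRMAn1_comb (hodd : Odd Lc) (cΛ : ℝ) (j' j : ℕ) (y : Fin (3 + 1) → ℤ) (ν : Fin (3 + 1)) (y' : Site (3 + 1))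
    (α β : Fin (3 + 1)) :
    HasSum (fun xz : Site (3 + 1) × Site (3 + 1) =>
      (if xz.1 α % (Lc : ℤ) = (Lc : ℤ) - 1 ∧ xz.2 β % (Lc : ℤ) = (Lc : ℤ) - 1 then (1 : ℝ) else 0)
        * vertexOfM (coDressKBmAt (ctr 4 Lc) Lc (KInvStep (d := 3) Lc j')) Lc (symRMAn1 Lc cΛ j y) ν y' xz.1 xz.2 (Sum.inl α) (Sum.inl β)) 0 := by
  obtain ⟨δG, CG, hδG, -, hG⟩ := decays_coDressKBmAt_KInvStep (d := 3) (ctrOff_mem_box (one_le_of_neZero Lc)) j'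
  exact hasSum_face_vertexOfM_symRMAn1 hodd cΛ ν y' (fun ρ w => abs_colM_le (N := Lc) hG ν y' ρ w) hδG j y α β

end Summit.QuantumFields.BalabanUV.Beta.GAN24.SymRMChargeFreeFace

end
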